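import Mathlib
import HarnessLib
import Summits.HubbardSuperconductivity.HubbardSuperconductivity.Theorems.KLProgrammeFreeBandJetTabB

/-!
# Route `KLProgramme` — ENGINE crux `KLRegimeEngineV17F2` (stmt-HubbardSuperconductivity-20437), row (C) `stub_twoLeg_curvature`,
# producer hypothesis `KlwjCertB` — KLWJ-INKERNEL part 3b, CERTIFICATE SLAB 8/8 for `klwjTableB`
# (cell gate-hubbard-kl, seat hubbard-kl-k3c5-p1 g21; docket «KLWJ-INKERNEL-ROUTE» (p1b g19 memo 5340b98f1348eb46); 0 kit)

Sub-certificates of the box certificate for the thirteen derivative rows of `klwjTableB` (window `[-11/10, -1/10]`, root box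
`[0, 7854/10⁴] × [1826/10³, 2826/10³]`, generator `py/cover2.py` + `py/split.py` of this seat, an exact mirror of the Lean arithmetic):
each `certB_<path>` is the sub-tree of the certificate at the dyadic sub-box reached by the binary `<path>` (`0` = lower/left half,
`1` = upper/right half; `splitH` halves the angle, `splitV` the radius, as recorded in the glue file `…FreeBandJetCertB`), and
`certB_<path>_ok` is ITS KERNEL EVALUATION `checkCert prmA jetProg jetIx tabB a b <sub-box> certB_<path> = true` (`decide +kernel`;
the sub-box endpoints are written as the unreduced midpoint expressions the glue produces).  By `checkCert_sound` (part 2b) each row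
holds at every point of the sub-box whose level lies in the window.  Data + kernel computation only; nothing here asserts row (C),
any stub of 20437, K3, U₀, the window, a margin or superconductivity in the Hubbard model.
-/

namespace Summit.HubbardSuperconductivity.HubbardSuperconductivity.Theorems.FreeBandJets

set_option linter.dupNamespace false -- summit = problem name (single-conjunct summit), D-0017


open Cert in
/-- Sub-certificate `1011` on the sub-box [0.19635, 0.3927] × [2.576, 2.826]: 47 leaves (17 checked, 30 outside the window). -/
def certB_1011 : Cert :=
  splitV (splitH (splitV (splitH (splitV (splitH (splitV (splitH (splitV (splitH (splitV (splitH (ok) (ok)) (splitH (ok) (ok))) (splitV (splitH (ok)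
  (splitV (splitH (ok) (skip)) (splitH (ok) (skip)))) (splitH (splitV (splitH (ok) (ok)) (splitH (ok) (skip))) (skip)))) (splitH (splitV (splitH (ok)
  (splitV (splitH (ok) (ok)) (splitH (ok) (skip)))) (splitH (splitV (splitH (ok) (ok)) (splitH (ok) (skip))) (skip))) (splitV (splitH (skip) (skip))
  (skip)))) (splitV (splitH (skip) (skip)) (skip))) (splitH (splitV (splitH (splitV (splitH (splitV (splitH (skip) (skip)) (skip)) (skip)) (skip))
  (skip)) (skip)) (skip))) (skip)) (splitH (skip) (skip))) (skip)) (splitH (skip) (skip))) (skip)) (splitH (skip) (skip))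

set_option maxRecDepth 100000 in
/-- Kernel evaluation of the sub-certificate `1011` on its sub-box. -/
theorem certB_1011_ok :
    checkCert prmA jetProg jetIx tabB (-11/10 : ℚ) (-1/10 : ℚ)
      (((0 : ℚ) + (((0 : ℚ) + (3927/5000 : ℚ)) / 2)) / 2) (((0 : ℚ) + (3927/5000 : ℚ)) / 2) (((((913/500 : ℚ) + (1413/500 : ℚ)) / 2) + (1413/500 : ℚ))
      / 2) (1413/500 : ℚ) certB_1011 = true := by
  decide +kernel

open Cert in
/-- Sub-certificate `11` on the sub-box [0.3927, 0.7854] × [2.326, 2.826]: 10 leaves (5 checked, 5 outside the window). -/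
def certB_11 : Cert :=
  splitV (splitH (splitV (splitH (splitV (splitH (ok) (ok)) (splitH (ok) (skip))) (ok)) (splitH (skip) (skip))) (ok)) (splitH (skip) (skip))

set_option maxRecDepth 100000 in
/-- Kernel evaluation of the sub-certificate `11` on its sub-box. -/
theorem certB_11_ok :
    checkCert prmA jetProg jetIx tabB (-11/10 : ℚ) (-1/10 : ℚ)
      (((0 : ℚ) + (3927/5000 : ℚ)) / 2) (3927/5000 : ℚ) (((913/500 : ℚ) + (1413/500 : ℚ)) / 2) (1413/500 : ℚ) certB_11 = true := by
  decide +kernel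

end Summit.HubbardSuperconductivity.HubbardSuperconductivity.Theorems.FreeBandJets
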